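import Mathlib
import Literature.AlgebraicGeometry.Resolution.CobordantGame
import Literature.AlgebraicGeometry.Resolution.CobordantChartCoefficients
import Literature.AlgebraicGeometry.Resolution.CobordantTupleGame
import Literature.AlgebraicGeometry.Resolution.FormalCoordinateChange
import Summits.ResolutionOfSingularities.ResolutionOfSingularities.Theorems.WeightedInvariantLocalWeightedDropWildTerminalStep

/-!
# `WeightedInvariant.LocalWeightedDrop`, line `hasse-ridge-face-selection`: the MOVES of the purely inseparable sub-game on
# `y^q + A₀(x₁,x₂)` — point step, curve step, and coordinate changes of the plane `x'`

Crux item stmt-ResolutionOfSingularities-8899 `LocalWeightedDrop` (route `ResolutionOfSingularities/WeightedInvariant`),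
serving the door `WeightedConstruction` stmt-ResolutionOfSingularities-0571.  [OURS · L1 W4.3, chain w43, stub worker 1
(gen 2): game-side API for the piece S3πM `stub_wildPurelyInseparableReductionWon` (Hauser–Perlega's reduction of
`z^{p^e} + F(x,y)` to the terminal cases uses only point blow-ups, cleanings `z ↦ z - g(x,y)` and changes of the parameters
`(x,y)`; PRIMS 60 (2024) §§2–6).  Not a statement of any manuscript; bookkeeping over the landed bricks.]

* `won_purePower_of_pointStep` (every `q ≥ 1`, every characteristic): `y^q + A₀` (`ord A₀ > q`) is won as soon as every
  SINGULAR point-blow-up successor `y^q + (s · B₀)|_{y_{i₀} = 0}` (exceptional point `c`, live slot `c_{i₀} ≠ 0`,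
  `A₀ ∘ chart(c) = s^{q+1} B₀`) is won — `won_monic_of_pointBlowup` on the collapsed tuple `(A₀, 0, …, 0)`;
* `won_purePower_of_curveStep`: `y^q + x_i^q A₀''` (`A₀''(0) = 0`) is won as soon as every singular successor
  `y^q + c^q · (A₀'' ∘ chart_i(c))|` of the blow-up of `V(x_i, y)` is won — `won_monic_of_curveBlowup`;
* `won_purePower_substX_iff`: `Won (y^q + A₀ ∘ θ) ↔ Won (y^q + A₀)` for every coordinate change `θ` of the PLANE `k[[x₁,x₂]]`
  (zero constant terms, invertible linear part) — flags `y₁ = y + h(x)` of Hauser–Perlega Lemma 1, swapping `x ↔ y`, scalings;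
  the change is extended by the identity on `y` (`WildPurePower.extendLast`, determinant `linMat_extendLast_det`).
Together with `WildPurePower.won_purePower_recentre_iff` / `exists_clean` (re-centring and cleaning) these are all the moves the
descent needs; what remains for S3πM is the measure (HP's `(d, n, s)`).
-/

set_option linter.dupNamespace false -- mandated namespace of this single-conjunct summit

namespace Summit.ResolutionOfSingularities.ResolutionOfSingularities.Theorems

open Literature.AlgebraicGeometry.Resolution
open Literature.AlgebraicGeometry.Resolution.CobordantGame

namespace WildPurePower

open MvPowerSeries WildTerminal

variable {k : Type} [Field k] {m : ℕ}

/-! ### Extending a coordinate change of the plane by the identity on `y` -/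

/-- The extension of `θ : x' ↦ θ(x')` by `y ↦ y`. -/
theorem extendLast_apply_castSucc (θ : Fin m → MvPowerSeries (Fin m) k) (i : Fin m) :
    (fun l : Fin (m + 1) => Fin.lastCases (motive := fun _ => MvPowerSeries (Fin (m + 1)) k) (X (Fin.last m))
      (fun i => rename (Fin.succAboveEmb (Fin.last m)) (θ i)) l) (Fin.castSucc i) =
      rename (Fin.succAboveEmb (Fin.last m)) (θ i) := by
  simp only [Fin.lastCases_castSucc]

/-- The extension fixes `y`. -/
theorem extendLast_apply_last (θ : Fin m → MvPowerSeries (Fin m) k) :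
    (fun l : Fin (m + 1) => Fin.lastCases (motive := fun _ => MvPowerSeries (Fin (m + 1)) k) (X (Fin.last m))
      (fun i => rename (Fin.succAboveEmb (Fin.last m)) (θ i)) l) (Fin.last m) = X (Fin.last m) := by
  simp only [Fin.lastCases_last]

/-- The extension has zero constant terms. -/
theorem constantCoeff_extendLast (θ : Fin m → MvPowerSeries (Fin m) k) (hθ : ∀ i, constantCoeff (θ i) = 0)
    (l : Fin (m + 1)) :
    constantCoeff ((fun l : Fin (m + 1) => Fin.lastCases (motive := fun _ => MvPowerSeries (Fin (m + 1)) k) (X (Fin.last m))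
      (fun i => rename (Fin.succAboveEmb (Fin.last m)) (θ i)) l) l) = 0 := by
  refine Fin.lastCases ?_ (fun i => ?_) l
  · rw [extendLast_apply_last, constantCoeff_X]
  · rw [extendLast_apply_castSucc, constantCoeff_rename, hθ]

/-- The extension acts on series in `x'` as `θ` does. -/
theorem subst_extendLast_rename (θ : Fin m → MvPowerSeries (Fin m) k) (hθ : ∀ i, constantCoeff (θ i) = 0)
    (A : MvPowerSeries (Fin m) k) :
    subst (fun l : Fin (m + 1) => Fin.lastCases (motive := fun _ => MvPowerSeries (Fin (m + 1)) k) (X (Fin.last m))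
        (fun i => rename (Fin.succAboveEmb (Fin.last m)) (θ i)) l) (rename (Fin.succAboveEmb (Fin.last m)) A) =
      rename (Fin.succAboveEmb (Fin.last m)) (subst θ A) := by
  rw [subst_rename_eq _ _ (constantCoeff_extendLast θ hθ) A, rename_subst_eq _ θ hθ A]
  congr 1
  funext i
  have hi : (Fin.succAboveEmb (Fin.last m)) i = Fin.castSucc i := by
    rw [Fin.coe_succAboveEmb, Fin.succAbove_last]
  rw [hi, Fin.lastCases_castSucc]

/-- THE EXTENDED CHANGE ON A PURE-POWER FORM: `(y^q + A₀) ∘ θ̃ = y^q + A₀ ∘ θ`. -/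
theorem subst_extendLast_purePower (θ : Fin m → MvPowerSeries (Fin m) k) (hθ : ∀ i, constantCoeff (θ i) = 0) (q : ℕ)
    (A₀ : MvPowerSeries (Fin m) k) :
    subst (fun l : Fin (m + 1) => Fin.lastCases (motive := fun _ => MvPowerSeries (Fin (m + 1)) k) (X (Fin.last m))
        (fun i => rename (Fin.succAboveEmb (Fin.last m)) (θ i)) l)
        (X (Fin.last m) ^ q + rename (Fin.succAboveEmb (Fin.last m)) A₀) =
      X (Fin.last m) ^ q + rename (Fin.succAboveEmb (Fin.last m)) (subst θ A₀) := by
  have hs := hasSubst_of_constantCoeff_zero (constantCoeff_extendLast θ hθ)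
  rw [← coe_substAlgHom hs, map_add, map_pow, coe_substAlgHom, subst_X hs, subst_extendLast_rename θ hθ]
  congr 2
  exact Fin.lastCases_last

/-- The linear part of the extension is `diag (linMat θ, 1)`: same determinant. -/
theorem linMat_extendLast_det (θ : Fin m → MvPowerSeries (Fin m) k) :
    (FormalCoordChange.linMat (fun l : Fin (m + 1) => Fin.lastCases (motive := fun _ => MvPowerSeries (Fin (m + 1)) k)
        (X (Fin.last m)) (fun i => rename (Fin.succAboveEmb (Fin.last m)) (θ i)) l)).det =
      (FormalCoordChange.linMat θ).det := by
  classical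
  rw [Matrix.det_succ_row _ (Fin.last m), Finset.sum_eq_single (Fin.last m)]
  · have hlast : FormalCoordChange.linMat (fun l : Fin (m + 1) => Fin.lastCases (motive := fun _ => MvPowerSeries (Fin (m + 1)) k)
        (X (Fin.last m)) (fun i => rename (Fin.succAboveEmb (Fin.last m)) (θ i)) l) (Fin.last m) (Fin.last m) = 1 := by
      rw [FormalCoordChange.linMat, Matrix.of_apply, Fin.lastCases_last, coeff_index_single_self_X]
    have hsub : (FormalCoordChange.linMat (fun l : Fin (m + 1) => Fin.lastCases (motive := fun _ => MvPowerSeries (Fin (m + 1)) k)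
        (X (Fin.last m)) (fun i => rename (Fin.succAboveEmb (Fin.last m)) (θ i)) l)).submatrix
        (Fin.last m).succAbove (Fin.last m).succAbove = FormalCoordChange.linMat θ := by
      ext i j
      have hsingle : (Finsupp.single (Fin.castSucc j) 1 : Fin (m + 1) →₀ ℕ) =
          Finsupp.embDomain (Fin.succAboveEmb (Fin.last m)) (Finsupp.single j 1) := by
        rw [Finsupp.embDomain_single, Fin.coe_succAboveEmb, Fin.succAbove_last]
      rw [Matrix.submatrix_apply, FormalCoordChange.linMat, FormalCoordChange.linMat, Matrix.of_apply, Matrix.of_apply,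
        Fin.succAbove_last, Fin.lastCases_castSucc, hsingle, coeff_embDomain_rename]
    rw [hlast, mul_one, hsub, Even.neg_one_pow ⟨(Fin.last m : ℕ), rfl⟩, one_mul]
  · intro j _ hj
    rw [FormalCoordChange.linMat, Matrix.of_apply, Fin.lastCases_last, coeff_index_single_X, if_neg hj, mul_zero, zero_mul]
  · intro h
    exact absurd (Finset.mem_univ _) h

/-- COORDINATE CHANGES OF THE PLANE ARE FREE: for `θ` a coordinate change of `k[[x']]` (zero constant terms, invertible
linear part), `y^q + A₀ ∘ θ` is won iff `y^q + A₀` is (flags `y₁ = y + h(x)`, swapping, scaling of Hauser–Perlega). -/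
theorem won_purePower_substX_iff (θ : Fin m → MvPowerSeries (Fin m) k) (hθ : ∀ i, constantCoeff (θ i) = 0)
    (hθdet : IsUnit (FormalCoordChange.linMat θ).det) (q : ℕ) (A₀ : MvPowerSeries (Fin m) k) :
    CobordantGame.Won k (m + 1) (X (Fin.last m) ^ q + rename (Fin.succAboveEmb (Fin.last m)) (subst θ A₀)) ↔
      CobordantGame.Won k (m + 1) (X (Fin.last m) ^ q + rename (Fin.succAboveEmb (Fin.last m)) A₀) := by
  rw [← subst_extendLast_purePower θ hθ q A₀]
  exact won_subst_iff (constantCoeff_extendLast θ hθ) (by rw [linMat_extendLast_det]; exact hθdet) _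

/-! ### The two blow-up moves on `y^q + A₀(x₁, x₂)` -/

/-- THE POINT STEP for `y^q + A₀(x₁,x₂)` (`ord A₀ > q ≥ 1`, every characteristic): if every SINGULAR successor
`y^q + (s · B₀)|_{y_{i₀} = 0}` of the point blow-up (exceptional point `c` with live slot `c_{i₀} ≠ 0`,
`A₀ ∘ chart(c) = s^{q+1} B₀`) is won, then `y^q + A₀` is won. -/
theorem won_purePower_of_pointStep (p : ℕ) (hp : p.Prime) (k : Type) [Field k] [CharP k p] {q : ℕ} (hq : 0 < q)
    (A₀ : MvPowerSeries (Fin 2) k) (hA₀ : (q : ℕ∞) < A₀.order)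
    (hsucc : ∀ (c : Fin 2 → k) (i₀ : Fin 2), c i₀ ≠ 0 → ∀ B₀ : MvPowerSeries (Fin (2 + 1)) k,
      MvPowerSeries.subst (CobordantChart.chart (fun _ : Fin 2 => 1) c) A₀ = MvPowerSeries.X 0 ^ (q + 1) * B₀ →
      CobordantGame.IsSingular k (MvPowerSeries.X (Fin.last 2) ^ q +
        MvPowerSeries.rename (Fin.succAboveEmb (Fin.last 2)) (TupleGame.slice i₀ (MvPowerSeries.X 0 * B₀))) →
      CobordantGame.Won k (2 + 1) (MvPowerSeries.X (Fin.last 2) ^ q +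
        MvPowerSeries.rename (Fin.succAboveEmb (Fin.last 2)) (TupleGame.slice i₀ (MvPowerSeries.X 0 * B₀)))) :
    CobordantGame.Won k (2 + 1) (MvPowerSeries.X (Fin.last 2) ^ q +
      MvPowerSeries.rename (Fin.succAboveEmb (Fin.last 2)) A₀) := by
  classical
  set T : Fin q → MvPowerSeries (Fin 2) k := fun j => if (j : ℕ) = 0 then A₀ else 0 with hT
  have hT0 : T ⟨0, hq⟩ = A₀ := if_pos rfl
  have hTne : ∀ j : Fin q, (j : ℕ) ≠ 0 → T j = 0 := fun j hj => if_neg hj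
  have h := won_monic_of_pointBlowup p hp k 2 q hq T (polyhedron_of_vanish hq T hTne (by rw [hT0]; exact hA₀)) ?_
  · rw [monicForm_eq_of_vanish hq T hTne, hT0] at h
    exact h
  · intro c i₀ hci₀ Bv hBv hS
    rw [monicForm_eq_of_vanish hq _ (fun j hj => pointCoeff_vanish c i₀ T hTne Bv hBv j hj)] at hS ⊢
    have hB0 := hBv ⟨0, hq⟩
    rw [hT0, show q - ((⟨0, hq⟩ : Fin q) : ℕ) + 1 = q + 1 by simp] at hB0
    exact hsucc c i₀ hci₀ (Bv ⟨0, hq⟩) hB0 hS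

/-- THE CURVE STEP for `y^q + x_i^q · A₀''(x₁,x₂)` (`A₀''(0) = 0`, every characteristic): if every SINGULAR successor
`y^q + c^q · (A₀'' ∘ chart_i(c))|` of the blow-up of `V(x_i, y)` (`c ≠ 0`) is won, then `y^q + x_i^q A₀''` is won. -/
theorem won_purePower_of_curveStep (p : ℕ) (hp : p.Prime) (k : Type) [Field k] [CharP k p] {q : ℕ} (hq : 0 < q)
    (i : Fin 2) (A₀'' : MvPowerSeries (Fin 2) k) (hA : MvPowerSeries.constantCoeff A₀'' = 0)
    (hsucc : ∀ ci : k, ci ≠ 0 →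
      CobordantGame.IsSingular k (MvPowerSeries.X (Fin.last 2) ^ q +
        MvPowerSeries.rename (Fin.succAboveEmb (Fin.last 2)) (MvPowerSeries.C (ci ^ q) * TupleGame.slice i
          (MvPowerSeries.subst (CobordantChart.chart (fun l : Fin 2 => if l = i then 1 else 0)
            (fun l : Fin 2 => if l = i then ci else 0)) A₀''))) →
      CobordantGame.Won k (2 + 1) (MvPowerSeries.X (Fin.last 2) ^ q +
        MvPowerSeries.rename (Fin.succAboveEmb (Fin.last 2)) (MvPowerSeries.C (ci ^ q) * TupleGame.slice i
          (MvPowerSeries.subst (CobordantChart.chart (fun l : Fin 2 => if l = i then 1 else 0)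
            (fun l : Fin 2 => if l = i then ci else 0)) A₀'')))) :
    CobordantGame.Won k (2 + 1) (MvPowerSeries.X (Fin.last 2) ^ q +
      MvPowerSeries.rename (Fin.succAboveEmb (Fin.last 2)) (MvPowerSeries.X i ^ q * A₀'')) := by
  classical
  set T : Fin q → MvPowerSeries (Fin 2) k := fun j => if (j : ℕ) = 0 then X i ^ q * A₀'' else 0 with hT
  set T'' : Fin q → MvPowerSeries (Fin 2) k := fun j => if (j : ℕ) = 0 then A₀'' else 0 with hT''
  have hT0 : T ⟨0, hq⟩ = X i ^ q * A₀'' := if_pos rfl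
  have hTne : ∀ j : Fin q, (j : ℕ) ≠ 0 → T j = 0 := fun j hj => if_neg hj
  have hT''0 : T'' ⟨0, hq⟩ = A₀'' := if_pos rfl
  have hT''ne : ∀ j : Fin q, (j : ℕ) ≠ 0 → T'' j = 0 := fun j hj => if_neg hj
  have hpoly : ∀ j : Fin q, ((q - (j : ℕ) : ℕ) : ℕ∞) < (T j).order := by
    refine polyhedron_of_vanish hq T hTne ?_
    rw [hT0, order_X_pow_mul]
    have h1 : (1 : ℕ∞) ≤ A₀''.order := one_le_order_iff_constCoeff_eq_zero.mpr hA
    calc ((q : ℕ) : ℕ∞) < (q : ℕ∞) + 1 := by exact_mod_cast Nat.lt_succ_self q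
      _ ≤ (q : ℕ∞) + A₀''.order := add_le_add le_rfl h1
  have h := won_monic_of_curveBlowup p hp k 2 q hq i T T'' ?_ ?_ ?_
  · rw [monicForm_eq_of_vanish hq T hTne, hT0] at h
    exact h
  · intro j
    by_cases hj : (j : ℕ) = 0
    · have hj' : j = ⟨0, hq⟩ := Fin.ext hj
      subst hj'
      rw [hT0, hT''0, show q - ((⟨0, hq⟩ : Fin q) : ℕ) = q by simp]
    · rw [hTne j hj, hT''ne j hj, mul_zero]
  · intro j
    by_cases hj : (j : ℕ) = 0
    · have hj' : j = ⟨0, hq⟩ := Fin.ext hj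
      subst hj'
      rw [hT''0]; exact hA
    · rw [hT''ne j hj, map_zero]
  · intro ci hci hS
    have hvan : ∀ j : Fin q, (j : ℕ) ≠ 0 → C (ci ^ (q - (j : ℕ))) * TupleGame.slice i (subst (CobordantChart.chart
        (fun l : Fin 2 => if l = i then 1 else 0) (fun l : Fin 2 => if l = i then ci else 0)) (T'' j)) = 0 := by
      intro j hj
      rw [hT''ne j hj, subst_axisChart_zero, slice_zero, mul_zero]
    rw [monicForm_eq_of_vanish hq _ hvan, hT''0, show q - ((⟨0, hq⟩ : Fin q) : ℕ) = q by simp] at hS ⊢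
    exact hsucc ci hci hS

end WildPurePower

end Summit.ResolutionOfSingularities.ResolutionOfSingularities.Theorems
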